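import Mathlib
import HarnessLib

/-!
# Leray capping, tools I: the hierarchy near the wall — periodicity and mirror algebra

Tools file for `stub_lerayCapping` of
`Summit.AnomalousDissipation.AnomalousDissipation.Theses.DyadicWallCascade.DyadicRealisation`
(line Sketch).  For a half-space hierarchy `(V, Q)` (dilation invariant under `X ↦ 2X`, and
`1`-periodic in `X₀, X₁` on the band `1 ≤ X₂ ≤ 2`):

* `lerayCapping_exists_dyadic_level` — every height `0 < t ≤ 2` has a dyadic multiple in `[1, 2]`;
* `lerayCapping_dilation_iter` — `V (2ⁿ X) = V X`;
* `lerayCapping_periodic_near_wall` — horizontal `1`-periodicity of `V, Q` on the whole layer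
  `0 < X₂ ≤ 2` (blow the point up to the band, shift there, blow down);
* `lerayCapping_int_shift` — integer horizontal shifts for functions periodic on a horizontal layer;
* `lerayCapping_reflection` — the mirror `σ X = X − 2X₂e₂` as a self-adjoint involutive linear
  isometry of `ℝ³`;
* `lerayCapping_mirror_euler` — the reflected pair `(σ ∘ V ∘ A, Q ∘ A)`, `A Y = σ Y + e₂`, is smooth,
  divergence free and solves steady Euler on `{Y₂ < 1}`.

The file ends with the registered tools stub `stub_lerayCappingTools`.
-/

open Set Function
open scoped BigOperators InnerProductSpace

set_option linter.dupNamespace false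

namespace Summit.AnomalousDissipation.AnomalousDissipation.Theorems

/-- Every height `0 < t ≤ 2` has a dyadic multiple `2ⁿ t` in the band `[1, 2]`. [folklore] -/
theorem lerayCapping_exists_dyadic_level (t : ℝ) (ht : 0 < t) (ht2 : t ≤ 2) :
    ∃ n : ℕ, 1 ≤ (2 : ℝ) ^ n * t ∧ (2 : ℝ) ^ n * t ≤ 2 := by
  classical
  have hex : ∃ n : ℕ, 1 ≤ (2 : ℝ) ^ n * t := by
    obtain ⟨n, hn⟩ := pow_unbounded_of_one_lt t⁻¹ (by norm_num : (1 : ℝ) < 2)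
    refine ⟨n, ?_⟩
    have : t⁻¹ * t = 1 := inv_mul_cancel₀ ht.ne'
    nlinarith [hn, ht]
  refine ⟨Nat.find hex, Nat.find_spec hex, ?_⟩
  rcases Nat.eq_zero_or_pos (Nat.find hex) with h0 | hpos
  · rw [h0, pow_zero, one_mul]; exact ht2
  · have hmin : ¬ (1 ≤ (2 : ℝ) ^ (Nat.find hex - 1) * t) := Nat.find_min hex (Nat.sub_lt hpos one_pos)
    rw [not_le] at hmin
    have : (2 : ℝ) ^ Nat.find hex = 2 * 2 ^ (Nat.find hex - 1) := by
      rw [← pow_succ', Nat.sub_add_cancel hpos]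
    rw [this]
    nlinarith [hmin]

/-- Iterated dilation invariance: `V (2ⁿ X) = V X` and `Q (2ⁿ X) = Q X` on the half-space. [folklore] -/
theorem lerayCapping_dilation_iter
    (V : EuclideanSpace ℝ (Fin 3) → EuclideanSpace ℝ (Fin 3)) (Q : EuclideanSpace ℝ (Fin 3) → ℝ)
    (hdil : ∀ X : EuclideanSpace ℝ (Fin 3), 0 < X 2 → V ((2 : ℝ) • X) = V X ∧ Q ((2 : ℝ) • X) = Q X)
    (n : ℕ) (X : EuclideanSpace ℝ (Fin 3)) (hX : 0 < X 2) :
    V ((2 : ℝ) ^ n • X) = V X ∧ Q ((2 : ℝ) ^ n • X) = Q X := by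
  induction n with
  | zero => simp
  | succ n ih =>
    have hpos : 0 < ((2 : ℝ) ^ n • X) 2 := by
      rw [PiLp.smul_apply, smul_eq_mul]; positivity
    have h := hdil ((2 : ℝ) ^ n • X) hpos
    rw [smul_smul, ← pow_succ'] at h
    exact ⟨h.1.trans ih.1, h.2.trans ih.2⟩

/-- **Horizontal periodicity near the wall.** A dilation-invariant pair which is `1`-periodic in
`X₀, X₁` on the band `1 ≤ X₂ ≤ 2` is `1`-periodic in `X₀, X₁` on the whole layer `0 < X₂ ≤ 2`.
[folklore] -/
theorem lerayCapping_periodic_near_wall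
    (V : EuclideanSpace ℝ (Fin 3) → EuclideanSpace ℝ (Fin 3)) (Q : EuclideanSpace ℝ (Fin 3) → ℝ)
    (hdil : ∀ X : EuclideanSpace ℝ (Fin 3), 0 < X 2 → V ((2 : ℝ) • X) = V X ∧ Q ((2 : ℝ) • X) = Q X)
    (hper : ∀ X : EuclideanSpace ℝ (Fin 3), 1 ≤ X 2 → X 2 ≤ 2 →
      V (X + EuclideanSpace.single 0 (1 : ℝ)) = V X ∧ V (X + EuclideanSpace.single 1 (1 : ℝ)) = V X ∧
      Q (X + EuclideanSpace.single 0 (1 : ℝ)) = Q X ∧ Q (X + EuclideanSpace.single 1 (1 : ℝ)) = Q X)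
    (X : EuclideanSpace ℝ (Fin 3)) (hX : 0 < X 2) (hX2 : X 2 ≤ 2) :
    V (X + EuclideanSpace.single 0 (1 : ℝ)) = V X ∧ V (X + EuclideanSpace.single 1 (1 : ℝ)) = V X ∧
      Q (X + EuclideanSpace.single 0 (1 : ℝ)) = Q X ∧ Q (X + EuclideanSpace.single 1 (1 : ℝ)) = Q X := by
  obtain ⟨n, hn1, hn2⟩ := lerayCapping_exists_dyadic_level (X 2) hX hX2
  -- natural multiples of the unit shifts on the band
  have hnat : ∀ (j : Fin 3), (j = 0 ∨ j = 1) → ∀ (m : ℕ) (Z : EuclideanSpace ℝ (Fin 3)),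
      1 ≤ Z 2 → Z 2 ≤ 2 →
      V (Z + (m : ℝ) • EuclideanSpace.single j (1 : ℝ)) = V Z ∧
        Q (Z + (m : ℝ) • EuclideanSpace.single j (1 : ℝ)) = Q Z := by
    intro j hj m
    induction m with
    | zero => intro Z _ _; simp
    | succ m ih =>
      intro Z hZ1 hZ2
      have hZ' : (Z + EuclideanSpace.single j (1 : ℝ)) 2 = Z 2 := by
        rcases hj with rfl | rfl <;> simp
      have hstep := hper Z hZ1 hZ2
      have hsV : V (Z + EuclideanSpace.single j (1 : ℝ)) = V Z := by
        rcases hj with rfl | rfl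
        · exact hstep.1
        · exact hstep.2.1
      have hsQ : Q (Z + EuclideanSpace.single j (1 : ℝ)) = Q Z := by
        rcases hj with rfl | rfl
        · exact hstep.2.2.1
        · exact hstep.2.2.2
      have heq : Z + ((m + 1 : ℕ) : ℝ) • EuclideanSpace.single j (1 : ℝ) =
          (Z + EuclideanSpace.single j (1 : ℝ)) + (m : ℝ) • EuclideanSpace.single j (1 : ℝ) := by
        rw [Nat.cast_succ, add_smul, one_smul]; abel
      have h := ih (Z + EuclideanSpace.single j (1 : ℝ)) (by rw [hZ']; exact hZ1) (by rw [hZ']; exact hZ2)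
      rw [heq]
      exact ⟨h.1.trans hsV, h.2.trans hsQ⟩
  -- blow up, shift, blow down
  have key : ∀ (j : Fin 3), (j = 0 ∨ j = 1) →
      V (X + EuclideanSpace.single j (1 : ℝ)) = V X ∧ Q (X + EuclideanSpace.single j (1 : ℝ)) = Q X := by
    intro j hj
    have hXj : 0 < (X + EuclideanSpace.single j (1 : ℝ)) 2 := by
      rcases hj with rfl | rfl <;> simpa using hX
    have h1 := lerayCapping_dilation_iter V Q hdil n (X + EuclideanSpace.single j (1 : ℝ)) hXj
    have h2 := lerayCapping_dilation_iter V Q hdil n X hX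
    have hZ2 : ((2 : ℝ) ^ n • X) 2 = (2 : ℝ) ^ n * X 2 := by simp
    have h3 := hnat j hj (2 ^ n) ((2 : ℝ) ^ n • X) (by rw [hZ2]; exact hn1) (by rw [hZ2]; exact hn2)
    have heq : (2 : ℝ) ^ n • (X + EuclideanSpace.single j (1 : ℝ)) =
        (2 : ℝ) ^ n • X + ((2 ^ n : ℕ) : ℝ) • EuclideanSpace.single j (1 : ℝ) := by
      rw [smul_add]; push_cast; rfl
    rw [heq] at h1
    exact ⟨(h1.1.symm.trans h3.1).trans h2.1, (h1.2.symm.trans h3.2).trans h2.2⟩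
  exact ⟨(key 0 (Or.inl rfl)).1, (key 1 (Or.inr rfl)).1, (key 0 (Or.inl rfl)).2, (key 1 (Or.inr rfl)).2⟩

/-- **Integer horizontal shifts.** If `G (X + v) = G X` for all `X` in a horizontal layer
`{X | p (X 2)}` and `v` is horizontal, then `G (X + k • v) = G X` there for every integer `k`.
[folklore] -/
theorem lerayCapping_int_shift {α : Type*} (G : EuclideanSpace ℝ (Fin 3) → α) (p : ℝ → Prop)
    (v : EuclideanSpace ℝ (Fin 3)) (hv : v 2 = 0)
    (hG : ∀ X : EuclideanSpace ℝ (Fin 3), p (X 2) → G (X + v) = G X) (k : ℤ)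
    (X : EuclideanSpace ℝ (Fin 3)) (hX : p (X 2)) : G (X + (k : ℝ) • v) = G X := by
  have hc : ∀ c : ℝ, (X + c • v) 2 = X 2 := fun c => by simp [hv]
  have hnat : ∀ (m : ℕ) (Z : EuclideanSpace ℝ (Fin 3)), p (Z 2) → G (Z + (m : ℝ) • v) = G Z := by
    intro m
    induction m with
    | zero => intro Z _; simp
    | succ m ih =>
      intro Z hZ
      have hZ' : p ((Z + v) 2) := by simpa [hv] using hZ
      have heq : Z + ((m + 1 : ℕ) : ℝ) • v = (Z + v) + (m : ℝ) • v := by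
        rw [Nat.cast_succ, add_smul, one_smul]; abel
      rw [heq, ih _ hZ', hG Z hZ]
  obtain ⟨m, rfl | rfl⟩ := Int.eq_nat_or_neg k
  · exact_mod_cast hnat m X hX
  · have h := hnat m (X + ((-(m : ℤ) : ℤ) : ℝ) • v) (by rw [hc]; exact hX)
    rw [add_assoc, ← add_smul] at h
    have : (((-(m : ℤ) : ℤ) : ℝ) + (m : ℝ)) = 0 := by push_cast; ring
    rw [this, zero_smul, add_zero] at h
    exact h.symm

/-- **The mirror reflection** `σ X = X − 2X₂e₂` of `ℝ³` in the wall plane is an involutive,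
self-adjoint linear isometry negating the third coordinate and the third basis vector. [folklore] -/
theorem lerayCapping_reflection :
    ∃ S : EuclideanSpace ℝ (Fin 3) →L[ℝ] EuclideanSpace ℝ (Fin 3),
      (∀ Y : EuclideanSpace ℝ (Fin 3), S Y = Y - (2 * Y 2) • EuclideanSpace.single 2 (1 : ℝ)) ∧
      (∀ Y : EuclideanSpace ℝ (Fin 3), S (S Y) = Y) ∧
      (∀ Y : EuclideanSpace ℝ (Fin 3), ‖S Y‖ = ‖Y‖) ∧
      (∀ Y Z : EuclideanSpace ℝ (Fin 3), ⟪S Y, Z⟫_ℝ = ⟪Y, S Z⟫_ℝ) ∧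
      (∀ Y : EuclideanSpace ℝ (Fin 3), (S Y) 0 = Y 0 ∧ (S Y) 1 = Y 1 ∧ (S Y) 2 = -Y 2) ∧
      (∀ i : Fin 3, S (EuclideanSpace.single i (1 : ℝ)) =
        (if i = 2 then (-1 : ℝ) else 1) • EuclideanSpace.single i (1 : ℝ)) := by
  set σ : EuclideanSpace ℝ (Fin 3) ≃ₗᵢ[ℝ] EuclideanSpace ℝ (Fin 3) :=
    LinearIsometryEquiv.piLpCongrRight 2 (fun i : Fin 3 =>
      if i = 2 then LinearIsometryEquiv.neg ℝ else LinearIsometryEquiv.refl ℝ ℝ) with hσ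
  have hσY : ∀ Y : EuclideanSpace ℝ (Fin 3),
      σ Y = Y - (2 * Y 2) • EuclideanSpace.single 2 (1 : ℝ) := by
    intro Y
    ext i
    fin_cases i <;> (simp [hσ, LinearIsometryEquiv.piLpCongrRight_apply]; try ring)
  have hcoord : ∀ Y : EuclideanSpace ℝ (Fin 3), (σ Y) 0 = Y 0 ∧ (σ Y) 1 = Y 1 ∧ (σ Y) 2 = -Y 2 := by
    intro Y
    refine ⟨?_, ?_, ?_⟩ <;> (rw [hσY]; simp; try ring)
  have hinv : ∀ Y : EuclideanSpace ℝ (Fin 3), σ (σ Y) = Y := by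
    intro Y
    ext i
    fin_cases i <;> (simp [hσY]; try ring)
  refine ⟨(σ : EuclideanSpace ℝ (Fin 3) →L[ℝ] EuclideanSpace ℝ (Fin 3)), fun Y => hσY Y, hinv,
    fun Y => σ.norm_map Y, fun Y Z => ?_, hcoord, fun i => ?_⟩
  · show ⟪σ Y, Z⟫_ℝ = ⟪Y, σ Z⟫_ℝ
    have h := σ.inner_map_map Y (σ Z)
    rw [hinv] at h
    exact h
  · show σ (EuclideanSpace.single i (1 : ℝ)) = _
    ext k
    fin_cases i <;> fin_cases k <;> (simp [hσY]; try norm_num)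

/-- **The reflected hierarchy.** For `(V, Q)` smooth, divergence free and steady Euler on the upper
half-space, the pair `T Y = σ (V (A Y))`, `q Y = Q (A Y)` with `A Y = Y + (1 − 2Y₂) e₂` (so
`(A Y)₂ = 1 − Y₂`) is smooth, divergence free and steady Euler on `{Y₂ < 1}`. [folklore] -/
theorem lerayCapping_mirror_euler
    (V : EuclideanSpace ℝ (Fin 3) → EuclideanSpace ℝ (Fin 3)) (Q : EuclideanSpace ℝ (Fin 3) → ℝ)
    (hV : ContDiffOn ℝ ((⊤ : ℕ∞) : WithTop ℕ∞) V {X : EuclideanSpace ℝ (Fin 3) | 0 < X 2})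
    (hQ : ContDiffOn ℝ ((⊤ : ℕ∞) : WithTop ℕ∞) Q {X : EuclideanSpace ℝ (Fin 3) | 0 < X 2})
    (hdiv : ∀ X : EuclideanSpace ℝ (Fin 3), 0 < X 2 →
      ∑ i : Fin 3, (fderiv ℝ V X (EuclideanSpace.single i (1 : ℝ))) i = 0)
    (hE : ∀ X : EuclideanSpace ℝ (Fin 3), 0 < X 2 → (fderiv ℝ V X) (V X) + gradient Q X = 0) :
    ContDiffOn ℝ ((⊤ : ℕ∞) : WithTop ℕ∞)
        (fun Y : EuclideanSpace ℝ (Fin 3) =>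
          V (Y + (1 - 2 * Y 2) • EuclideanSpace.single 2 (1 : ℝ)) -
            (2 * (V (Y + (1 - 2 * Y 2) • EuclideanSpace.single 2 (1 : ℝ))) 2) •
              EuclideanSpace.single 2 (1 : ℝ))
        {Y : EuclideanSpace ℝ (Fin 3) | Y 2 < 1} ∧
      ContDiffOn ℝ ((⊤ : ℕ∞) : WithTop ℕ∞)
        (fun Y : EuclideanSpace ℝ (Fin 3) => Q (Y + (1 - 2 * Y 2) • EuclideanSpace.single 2 (1 : ℝ)))
        {Y : EuclideanSpace ℝ (Fin 3) | Y 2 < 1} ∧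
      (∀ Y : EuclideanSpace ℝ (Fin 3), Y 2 < 1 →
        ∑ i : Fin 3, ((fderiv ℝ (fun Y : EuclideanSpace ℝ (Fin 3) =>
          V (Y + (1 - 2 * Y 2) • EuclideanSpace.single 2 (1 : ℝ)) -
            (2 * (V (Y + (1 - 2 * Y 2) • EuclideanSpace.single 2 (1 : ℝ))) 2) •
              EuclideanSpace.single 2 (1 : ℝ)) Y (EuclideanSpace.single i (1 : ℝ)) :
                EuclideanSpace ℝ (Fin 3)) i) = 0) ∧
      (∀ Y : EuclideanSpace ℝ (Fin 3), Y 2 < 1 →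
        fderiv ℝ (fun Y : EuclideanSpace ℝ (Fin 3) =>
          V (Y + (1 - 2 * Y 2) • EuclideanSpace.single 2 (1 : ℝ)) -
            (2 * (V (Y + (1 - 2 * Y 2) • EuclideanSpace.single 2 (1 : ℝ))) 2) •
              EuclideanSpace.single 2 (1 : ℝ)) Y
          (V (Y + (1 - 2 * Y 2) • EuclideanSpace.single 2 (1 : ℝ)) -
            (2 * (V (Y + (1 - 2 * Y 2) • EuclideanSpace.single 2 (1 : ℝ))) 2) •
              EuclideanSpace.single 2 (1 : ℝ)) +
        gradient (fun Y : EuclideanSpace ℝ (Fin 3) =>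
          Q (Y + (1 - 2 * Y 2) • EuclideanSpace.single 2 (1 : ℝ))) Y = 0) := by
  obtain ⟨S, hS, hSS, -, hSadj, hSco, hSe⟩ := lerayCapping_reflection
  set e2 : EuclideanSpace ℝ (Fin 3) := EuclideanSpace.single 2 (1 : ℝ) with he2
  -- the affine map `A Y = S Y + e₂`
  set A : EuclideanSpace ℝ (Fin 3) → EuclideanSpace ℝ (Fin 3) := fun Y => Y + (1 - 2 * Y 2) • e2 with hA
  have hAS : ∀ Y, A Y = S Y + e2 := by
    intro Y; rw [hS Y, hA]; module
  have hA2 : ∀ Y, (A Y) 2 = 1 - Y 2 := by intro Y; simp [hA, he2]; ring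
  have hAsm : ContDiff ℝ ((⊤ : ℕ∞) : WithTop ℕ∞) A := by
    have : A = fun Y => S Y + e2 := funext hAS
    rw [this]; exact S.contDiff.add contDiff_const
  have hAd : ∀ Y, HasFDerivAt A S Y := by
    intro Y
    have : A = fun Y => S Y + e2 := funext hAS
    rw [this]; exact S.hasFDerivAt.add_const e2
  have hmaps : MapsTo A {Y : EuclideanSpace ℝ (Fin 3) | Y 2 < 1} {X : EuclideanSpace ℝ (Fin 3) | 0 < X 2} := by
    intro Y hY; simp only [mem_setOf_eq] at hY ⊢; rw [hA2]; linarith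
  -- the reflected fields
  have hTdef : (fun Y : EuclideanSpace ℝ (Fin 3) => V (A Y) - (2 * (V (A Y)) 2) • e2) =
      fun Y => S (V (A Y)) := by
    funext Y; rw [hS]
  have hVA : ContDiffOn ℝ ((⊤ : ℕ∞) : WithTop ℕ∞) (fun Y => V (A Y)) {Y : EuclideanSpace ℝ (Fin 3) | Y 2 < 1} :=
    hV.comp hAsm.contDiffOn hmaps
  have hT : ContDiffOn ℝ ((⊤ : ℕ∞) : WithTop ℕ∞) (fun Y => S (V (A Y))) {Y : EuclideanSpace ℝ (Fin 3) | Y 2 < 1} :=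
    S.contDiff.comp_contDiffOn hVA
  have hq : ContDiffOn ℝ ((⊤ : ℕ∞) : WithTop ℕ∞) (fun Y => Q (A Y)) {Y : EuclideanSpace ℝ (Fin 3) | Y 2 < 1} :=
    hQ.comp hAsm.contDiffOn hmaps
  have hopen : IsOpen {X : EuclideanSpace ℝ (Fin 3) | 0 < X 2} :=
    isOpen_lt continuous_const (PiLp.continuous_apply 2 _ 2)
  -- derivatives at a point below height 1
  have hderiv : ∀ Y : EuclideanSpace ℝ (Fin 3), Y 2 < 1 →
      HasFDerivAt (fun Y => S (V (A Y))) ((S.comp (fderiv ℝ V (A Y))).comp S) Y ∧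
      HasFDerivAt (fun Y => Q (A Y)) ((fderiv ℝ Q (A Y)).comp S) Y := by
    intro Y hY
    have hAY : 0 < (A Y) 2 := by rw [hA2]; linarith
    have hVd : DifferentiableAt ℝ V (A Y) :=
      (hV.differentiableOn (by simp)).differentiableAt (hopen.mem_nhds hAY)
    have hQd : DifferentiableAt ℝ Q (A Y) :=
      (hQ.differentiableOn (by simp)).differentiableAt (hopen.mem_nhds hAY)
    refine ⟨?_, hQd.hasFDerivAt.comp Y (hAd Y)⟩
    exact S.hasFDerivAt.comp Y (hVd.hasFDerivAt.comp Y (hAd Y))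
  refine ⟨by rw [hTdef]; exact hT, hq, fun Y hY => ?_, fun Y hY => ?_⟩
  · -- divergence
    rw [hTdef, (hderiv Y hY).1.fderiv]
    have hAY : 0 < (A Y) 2 := by rw [hA2]; linarith
    have h0 := hdiv (A Y) hAY
    simp only [ContinuousLinearMap.coe_comp, comp_apply]
    have hterm : ∀ i : Fin 3, (S ((fderiv ℝ V (A Y)) (S (EuclideanSpace.single i (1 : ℝ))))) i =
        ((fderiv ℝ V (A Y)) (EuclideanSpace.single i (1 : ℝ))) i := by
      intro i
      rw [hSe i, map_smul]
      fin_cases i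
      · simp [(hSco _).1]
      · simp [(hSco _).2.1]
      · simp [(hSco _).2.2]
    simp_rw [hterm]
    exact h0
  · -- Euler
    rw [hTdef, (hderiv Y hY).1.fderiv]
    have hAY : 0 < (A Y) 2 := by rw [hA2]; linarith
    have h0 := hE (A Y) hAY
    have hgrad : gradient (fun Y => Q (A Y)) Y = S (gradient Q (A Y)) := by
      have hg : HasGradientAt (fun Y => Q (A Y))
          ((InnerProductSpace.toDual ℝ (EuclideanSpace ℝ (Fin 3))).symm ((fderiv ℝ Q (A Y)).comp S)) Y :=
        (hderiv Y hY).2.hasGradientAt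
      rw [hg.gradient]
      refine ext_inner_right ℝ fun w => ?_
      rw [InnerProductSpace.toDual_symm_apply, hSadj, gradient, InnerProductSpace.toDual_symm_apply]
      rfl
    have hTY : V (Y + (1 - 2 * Y 2) • e2) - (2 * (V (Y + (1 - 2 * Y 2) • e2)) 2) • e2 =
        S (V (A Y)) := by rw [hS]
    rw [hgrad, hTY]
    simp only [ContinuousLinearMap.coe_comp, comp_apply, hSS]
    rw [← map_add, h0, map_zero]

/-- Registered tools stub of `stub_lerayCapping` (line Sketch of crux `DyadicRealisation`): the
conjunction of the lemmas of this file. [folklore] -/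
theorem stub_lerayCappingTools :
    (∀ (t : ℝ), 0 < t → t ≤ 2 → ∃ n : ℕ, 1 ≤ (2 : ℝ) ^ n * t ∧ (2 : ℝ) ^ n * t ≤ 2) ∧
    (∀ (V : EuclideanSpace ℝ (Fin 3) → EuclideanSpace ℝ (Fin 3)) (Q : EuclideanSpace ℝ (Fin 3) → ℝ),
      (∀ X : EuclideanSpace ℝ (Fin 3), 0 < X 2 → V ((2 : ℝ) • X) = V X ∧ Q ((2 : ℝ) • X) = Q X) →
      ∀ (n : ℕ) (X : EuclideanSpace ℝ (Fin 3)), 0 < X 2 →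
        V ((2 : ℝ) ^ n • X) = V X ∧ Q ((2 : ℝ) ^ n • X) = Q X) ∧
    (∀ (V : EuclideanSpace ℝ (Fin 3) → EuclideanSpace ℝ (Fin 3)) (Q : EuclideanSpace ℝ (Fin 3) → ℝ),
      (∀ X : EuclideanSpace ℝ (Fin 3), 0 < X 2 → V ((2 : ℝ) • X) = V X ∧ Q ((2 : ℝ) • X) = Q X) →
      (∀ X : EuclideanSpace ℝ (Fin 3), 1 ≤ X 2 → X 2 ≤ 2 →
        V (X + EuclideanSpace.single 0 (1 : ℝ)) = V X ∧ V (X + EuclideanSpace.single 1 (1 : ℝ)) = V X ∧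
        Q (X + EuclideanSpace.single 0 (1 : ℝ)) = Q X ∧ Q (X + EuclideanSpace.single 1 (1 : ℝ)) = Q X) →
      ∀ X : EuclideanSpace ℝ (Fin 3), 0 < X 2 → X 2 ≤ 2 →
        V (X + EuclideanSpace.single 0 (1 : ℝ)) = V X ∧ V (X + EuclideanSpace.single 1 (1 : ℝ)) = V X ∧
        Q (X + EuclideanSpace.single 0 (1 : ℝ)) = Q X ∧ Q (X + EuclideanSpace.single 1 (1 : ℝ)) = Q X) ∧
    (∀ {α : Type*} (G : EuclideanSpace ℝ (Fin 3) → α) (p : ℝ → Prop) (v : EuclideanSpace ℝ (Fin 3)), v 2 = 0 →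
      (∀ X : EuclideanSpace ℝ (Fin 3), p (X 2) → G (X + v) = G X) →
      ∀ (k : ℤ) (X : EuclideanSpace ℝ (Fin 3)), p (X 2) → G (X + (k : ℝ) • v) = G X) ∧
    (∃ S : EuclideanSpace ℝ (Fin 3) →L[ℝ] EuclideanSpace ℝ (Fin 3),
      (∀ Y : EuclideanSpace ℝ (Fin 3), S Y = Y - (2 * Y 2) • EuclideanSpace.single 2 (1 : ℝ)) ∧
      (∀ Y : EuclideanSpace ℝ (Fin 3), S (S Y) = Y) ∧
      (∀ Y : EuclideanSpace ℝ (Fin 3), ‖S Y‖ = ‖Y‖) ∧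
      (∀ Y Z : EuclideanSpace ℝ (Fin 3), ⟪S Y, Z⟫_ℝ = ⟪Y, S Z⟫_ℝ) ∧
      (∀ Y : EuclideanSpace ℝ (Fin 3), (S Y) 0 = Y 0 ∧ (S Y) 1 = Y 1 ∧ (S Y) 2 = -Y 2) ∧
      (∀ i : Fin 3, S (EuclideanSpace.single i (1 : ℝ)) =
        (if i = 2 then (-1 : ℝ) else 1) • EuclideanSpace.single i (1 : ℝ))) ∧
    (∀ (V : EuclideanSpace ℝ (Fin 3) → EuclideanSpace ℝ (Fin 3)) (Q : EuclideanSpace ℝ (Fin 3) → ℝ),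
      ContDiffOn ℝ ((⊤ : ℕ∞) : WithTop ℕ∞) V {X : EuclideanSpace ℝ (Fin 3) | 0 < X 2} →
      ContDiffOn ℝ ((⊤ : ℕ∞) : WithTop ℕ∞) Q {X : EuclideanSpace ℝ (Fin 3) | 0 < X 2} →
      (∀ X : EuclideanSpace ℝ (Fin 3), 0 < X 2 →
        ∑ i : Fin 3, (fderiv ℝ V X (EuclideanSpace.single i (1 : ℝ))) i = 0) →
      (∀ X : EuclideanSpace ℝ (Fin 3), 0 < X 2 → (fderiv ℝ V X) (V X) + gradient Q X = 0) →
      ContDiffOn ℝ ((⊤ : ℕ∞) : WithTop ℕ∞)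
          (fun Y : EuclideanSpace ℝ (Fin 3) =>
            V (Y + (1 - 2 * Y 2) • EuclideanSpace.single 2 (1 : ℝ)) -
              (2 * (V (Y + (1 - 2 * Y 2) • EuclideanSpace.single 2 (1 : ℝ))) 2) •
                EuclideanSpace.single 2 (1 : ℝ))
          {Y : EuclideanSpace ℝ (Fin 3) | Y 2 < 1} ∧
        ContDiffOn ℝ ((⊤ : ℕ∞) : WithTop ℕ∞)
          (fun Y : EuclideanSpace ℝ (Fin 3) => Q (Y + (1 - 2 * Y 2) • EuclideanSpace.single 2 (1 : ℝ)))
          {Y : EuclideanSpace ℝ (Fin 3) | Y 2 < 1} ∧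
        (∀ Y : EuclideanSpace ℝ (Fin 3), Y 2 < 1 →
          ∑ i : Fin 3, ((fderiv ℝ (fun Y : EuclideanSpace ℝ (Fin 3) =>
            V (Y + (1 - 2 * Y 2) • EuclideanSpace.single 2 (1 : ℝ)) -
              (2 * (V (Y + (1 - 2 * Y 2) • EuclideanSpace.single 2 (1 : ℝ))) 2) •
                EuclideanSpace.single 2 (1 : ℝ)) Y (EuclideanSpace.single i (1 : ℝ)) :
                  EuclideanSpace ℝ (Fin 3)) i) = 0) ∧
        (∀ Y : EuclideanSpace ℝ (Fin 3), Y 2 < 1 →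
          fderiv ℝ (fun Y : EuclideanSpace ℝ (Fin 3) =>
            V (Y + (1 - 2 * Y 2) • EuclideanSpace.single 2 (1 : ℝ)) -
              (2 * (V (Y + (1 - 2 * Y 2) • EuclideanSpace.single 2 (1 : ℝ))) 2) •
                EuclideanSpace.single 2 (1 : ℝ)) Y
            (V (Y + (1 - 2 * Y 2) • EuclideanSpace.single 2 (1 : ℝ)) -
              (2 * (V (Y + (1 - 2 * Y 2) • EuclideanSpace.single 2 (1 : ℝ))) 2) •
                EuclideanSpace.single 2 (1 : ℝ)) +
          gradient (fun Y : EuclideanSpace ℝ (Fin 3) =>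
            Q (Y + (1 - 2 * Y 2) • EuclideanSpace.single 2 (1 : ℝ))) Y = 0)) :=
  ⟨lerayCapping_exists_dyadic_level, lerayCapping_dilation_iter, lerayCapping_periodic_near_wall,
    fun G p v hv hG k X hX => lerayCapping_int_shift G p v hv hG k X hX, lerayCapping_reflection,
    lerayCapping_mirror_euler⟩

end Summit.AnomalousDissipation.AnomalousDissipation.Theorems
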